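import Literature.Geometry.Kaehler.ComplexTorusMixedHardLefschetzPZero
import Literature.Geometry.Kaehler.ComplexTorusMixedHardLefschetzDegreeTwo
import Literature.Geometry.Kaehler.ComplexTorusLefschetzDecomposition
import Literature.Geometry.Kaehler.ComplexTorusPoincareDuality
import HarnessLib

/-!
# The mixed Lefschetz decomposition `Λ^{p+1,q+1} = P^{p+1,q+1} ⊕ ω ∧ Λ^{p,q}` and the non-degeneracy of the
# mixed Hodge–Riemann pairing on `Λ^{p,q}`, in EVERY bidegree, from mixed hard Lefschetz
# (Dinh–Nguyên 2006, Prop. 2.1 (a), (c) = Timorin 1998, Proposition 1 / Corollary 2; Cattani 2008, Thm. 2.2)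

Layer `Literature/Geometry/Kaehler`, namespace `Literature.Geometry.Kaehler.ComplexTorus`; lane `lit-hodgefound`
(Track 2 foundations library, Layer A: Hodge theory of complex tori on invariant forms), seat p16, generation 24
(row g24-#2). Second file of the programme "Timorin's mixed Hodge–Riemann bilinear relations in general bidegree
`(p,q)` on a complex torus" (first file: `Literature/LinearAlgebra/QuadraticForm/SignatureContinuousFamily`, the
deformation lemma). The tree has the mixed theorems in bidegrees `(1,1)` (`ComplexTorusMixedHodgeIndex*`),
`(2,0)`, `(p,0)`/`(0,p)` (`ComplexTorusMixedHodgeRiemannPZero`, `ComplexTorusMixedHardLefschetzPZero`) and in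
degrees `1, 2` (`ComplexTorusMixedHardLefschetzDegreeTwo`); here the ALGEBRAIC ENGINE of the general case, valid in
every bidegree: the two implications "mixed hard Lefschetz in degree `p + q` ⇒ mixed Lefschetz decomposition of
`Λ^{p+1,q+1}` with the dimension of the mixed primitive space" and "mixed hard Lefschetz in degree `p + q` ⇒ the
sesquilinear pairing `(A, B) ↦ ∫_X Ω ∧ A ∧ B̄` is non-degenerate on `Λ^{p,q}`" (Poincaré duality), with the
unconditional consequences in degrees `≤ 4` where the tree already has mixed hard Lefschetz. Two definitions with
bodies (`mixedLefschetz`, generalising the tree's `lefschetzPow` to a family of `2`-forms — junction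
`lefschetzPow_eq_mixedLefschetz` by `rfl`; `mixedPrimitiveForms`, generalising `primitiveForms` — junction
`primitiveForms_eq_mixedPrimitiveForms`), theorems otherwise; no named fact (net debt 0).

## Sources (verbatim, held copies)

* T.-C. Dinh, V.-A. Nguyên, *The mixed Hodge–Riemann bilinear relations for compact Kähler manifolds*, GAFA 16
  (2006) 838–849 [DinhNguyen2006] (held `paper:arxiv-math_0501449`), §2 p. 5 (chunk p0005 L9–L45):
  "**Proposition 2.1.** Let `p, q` be integers such that `0 ≤ p, q ≤ p + q ≤ n` and `ω_1, …, ω_{n-p-q+1}` strictly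
  positive forms of `Λ^{1,1}(ℂⁿ)`. Define the sesquilinear Hermitian symmetric form
  `Q(α, β) := i^{p-q} (-1)^{(n-p-q)(n-p-q-1)/2} ∗(α ∧ β̄ ∧ Ω)`, `α, β ∈ Λ^{p,q}(ℂⁿ)`, where `∗` is the Hodge star
  operator, and `Ω := ω_1 ∧ ⋯ ∧ ω_{n-p-q}`. Define the mixed primitive subspace
  `P^{p,q}(ℂⁿ) := {α ∈ Λ^{p,q}(ℂⁿ) : α ∧ Ω ∧ ω_{n-p-q+1} = 0}`. Then (a) The operator of multiplication by `Ω`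
  induces an isomorphism between `Λ^{p,q}(ℂⁿ)` and `Λ^{n-q,n-p}(ℂⁿ)`. (b) `Q(·,·)` is positive definite on
  `P^{p,q}(ℂⁿ)`. (c) The space `Λ^{p,q}(ℂⁿ)` splits into the `Q`-orthogonal direct sum
  `Λ^{p,q}(ℂⁿ) = P^{p,q}(ℂⁿ) ⊕ ω_{n-p-q+1} ∧ Λ^{p-1,q-1}(ℂⁿ)`, with the convention that `Λ^{p-1,q-1}(ℂⁿ) := 0`
  if either `p = 0` or `q = 0`. Proof. See Proposition 1, the Main Theorem and Corollary 2 in [Timorin 1998]."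
* V. A. Timorin, *Mixed Hodge–Riemann bilinear relations in a linear context*, Funct. Anal. Appl. 32 (1998)
  268–272 [Timorin1998] (NOT held; doi:10.1007/bf02463209), Proposition 1 and Corollary 2 as relayed by
  Dinh–Nguyên loc. cit.
* E. Cattani, *Mixed Lefschetz theorems and Hodge–Riemann bilinear relations*, IMRN 2008 [Cattani2008MixedLefschetz]
  (held `paper:arxiv-0707.1352`), §2 p. 4 (chunk p0004): "**Definition 2.1.** […] `N ∈ End_{-2}(V)` […] is said
  to satisfy the Lefschetz property relative to `V_*` if and only if `N^ℓ : V_ℓ → V_{-ℓ}` is an isomorphism for all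
  `ℓ ≥ 0`. […] **Theorem 2.2.** Let `V = V_*` be a `ℤ`-graded finite-dimensional real vector space and
  `N ∈ End_{-2}(V)` an endomorphism satisfying the Lefschetz property relative to `V_*`. Then, for every `m ≥ 0`,
  `V_m = (ker(N^{m+1}) ∩ V_m) ⊕ N V_{m+2}`"; §1 Thms. 1.3 / 1.4 (mixed HLT / HRR with `L_{ω_1} ⋯ L_{ω_m}`).
* C. Voisin, *Hodge Theory and Complex Algebraic Geometry I* (2002) [VoisinHodgeI2002], §2.3.1 (types add under
  `∧`, `conj Λ^{p,q} = Λ^{q,p}`), §6.3.2 proof of Thm. 6.33 (non-degeneracy from hard Lefschetz + Poincaré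
  duality), §7.1.2 (pairings of types vanish unless complementary); D. Huybrechts, *Complex Geometry* (2005)
  [Huybrechts2005], Prop. 1.2.30 (ii) (the unmixed Lefschetz decomposition); H. Lange, *Abelian Varieties over the
  Complex Numbers* (2023) [Lange2023AbelianVarietiesComplex], §1.1.5 Prop. 1.1.23 (`dim Λ^{p,q} = C(g,p) C(g,q)`),
  §6.2.4 (Poincaré duality on `H(X, ℂ)`), §7.3.1–7.3.2 (monomials, `L`, `P^k = ker L^{g-k+1}`); F. Warner
  [WarnerGTM94], 2.6 (associativity of `∧`, even forms central).

## What is proved (degree `k = m + 2`, background written as ONE family `Θ = (θ_1, …, θ_r, ω)`, `ω = θ_{r+1}`)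

* §1 `mixedLefschetz Θ h : ψ ↦ (θ_1 ∧ ⋯ ∧ θ_r) ∧ ψ` (`ℂ`-linear, target degree `2r + m = k` explicit;
  `lefschetzPow_eq_mixedLefschetz`), `mixedPrimitiveForms Θ m = ker L_Θ` (`primitiveForms_eq_mixedPrimitiveForms`);
  `mixedLefschetz_wedge_last`: `L_{(Θ',ω)} (C ∧ ω) = L_{(Θ',ω,ω)} C`.
* §2 types: `L_Θ Λ^{p,q} ⊆ Λ^{r+p, r+q}` (Prop. 2.1 (a), inclusion), conjugation stability of `P_Θ` for real `Θ`.
* §3 **Prop. 2.1 (c) from (a)**: if `(θ_1 ∧ ⋯ ∧ θ_r ∧ ω ∧ ω) ∧ ·` is injective on `Λ^{p,q}` (mixed hard Lefschetz in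
  degree `p + q` for the family with `ω` repeated; dimension `g = r + p + q + 2`), then every `A ∈ Λ^{p+1,q+1}` is
  uniquely `B + C ∧ ω` with `B ∈ P^{p+1,q+1} := ker((θ_1 ∧ ⋯ ∧ θ_r ∧ ω) ∧ ·) ∩ Λ^{p+1,q+1}`, `C ∈ Λ^{p,q}`
  (`exists_mem_mixedPrimitiveForms_add_wedge_eq`, `eq_zero_of_mem_mixedPrimitiveForms_of_add_wedge_eq_zero`), and
  **`dim P^{p+1,q+1} = C(g,p+1) C(g,q+1) - C(g,p) C(g,q)`** (`finrank_mixedPrimitiveForms_inf_typeSubmodule`).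
* §4 the splitting is `Q`-orthogonal and `Q` restricted to `ω ∧ Λ^{p,q}` is the degree-`(p+q)` pairing of the
  background `(θ_1, …, θ_r, ω, ω)` (identities in the ring of graded forms; `ω` real).
* §5 **non-degeneracy from (a)** on a torus `X = E/Φ(ℤ^ι)` of dimension `r + p + q`: if `Ω ∧ ·` is injective on
  `Λ^{p,q}` (`Ω = θ_1 ∧ ⋯ ∧ θ_r`), then `∫_X Ω ∧ A ∧ B̄ = 0` for all `B ∈ Λ^{p,q}` forces `A = 0`
  (`eq_zero_of_forall_torusIntegral_wedge_conjForm_eq_zero`; Poincaré duality `ComplexTorusPoincareDuality`).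
* §6 unconditional on a torus with POSITIVE `(1,1)` background (mixed hard Lefschetz in degrees `0, 1, 2` is in the
  tree): the decomposition and `dim P^{p+1,q+1}` for `p + q ≤ 2`, i.e. for `Λ^{1,1}`, `Λ^{2,1}`, `Λ^{1,2}`, `Λ^{3,1}`,
  `Λ^{2,2}`, `Λ^{1,3}` (`mixedLefschetzDecomposition_degTwo/degThree/degFour_of_pos`).

NOT claimed here: Prop. 2.1 (a) and (b) themselves in degrees `≥ 3` (the remaining files of the programme:
hyperplane restriction, then the induction on the dimension with the deformation lemma).
-/

noncomputable section

set_option maxSynthPendingDepth 3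

open scoped ComplexConjugate ComplexOrder
open Complex Function Module Finset
open Literature.LinearAlgebra.Alternating
open Literature.Analysis.Complex (oneForm₀ IsOfTypeAt typeSubmodule isOfTypeAt_of_mem_typeSubmodule finrank_typeSubmodule
  finrank_alt_real_complex typeProjAt sum_antidiagonal_typeProjAt isOfTypeAt_typeProjAt isOfTypeAt_oneForm₀)

namespace Literature.Geometry.Kaehler

namespace ComplexTorus

/-! ## §1 The mixed Lefschetz operator `L_Θ : ψ ↦ (θ_1 ∧ ⋯ ∧ θ_r) ∧ ψ` and the mixed primitive forms -/

section Defs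

variable {E : Type*} [NormedAddCommGroup E] [NormedSpace ℂ E]

/-- **The mixed Lefschetz operator `L_Θ : ⋀ᵐ V → ⋀ᵏ V`, `ψ ↦ (θ_1 ∧ ⋯ ∧ θ_r) ∧ ψ`** (`k = 2r + m`) of a family
`Θ = (θ_1, …, θ_r)` of complex `2`-forms on the invariant forms of a complex torus — "the operator of
multiplication by `Ω := ω_1 ∧ ⋯ ∧ ω_{n-p-q}`" (Dinh–Nguyên), Cattani's `L_{ω_1} ⋯ L_{ω_m}` — as a `ℂ`-linear map
with explicit target degree (no subtraction of degrees; for the constant family it is the tree's `lefschetzPow`,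
`lefschetzPow_eq_mixedLefschetz`). [cite: DinhNguyen2006, §2 Prop. 2.1 (arXiv PDF p. 5)]
[cite: Cattani2008MixedLefschetz, Thm. 1.3] -/
def mixedLefschetz {r : ℕ} (Θ : Fin r → E [⋀^Fin 2]→L[ℝ] ℂ) {m k : ℕ} (h : 2 * r + m = k) :
    (E [⋀^Fin m]→L[ℝ] ℂ) →ₗ[ℂ] (E [⋀^Fin k]→L[ℝ] ℂ) where
  toFun ψ := ((wedgeFamily r Θ).wedge ψ).domDomCongr (finCongr h)
  map_add' a b := by
    rw [ContinuousAlternatingMap.wedge_add_right, ContinuousAlternatingMap.domDomCongr_add]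
  map_smul' c a := by
    rw [RingHom.id_apply, wedge_smul_right_complex, domDomCongr_finCongr_smul]

/-- `L_Θ ψ = (θ_1 ∧ ⋯ ∧ θ_r) ∧ ψ`, reindexed. [cite: DinhNguyen2006, §2 Prop. 2.1 (arXiv PDF p. 5)] -/
theorem mixedLefschetz_apply {r : ℕ} (Θ : Fin r → E [⋀^Fin 2]→L[ℝ] ℂ) {m k : ℕ} (h : 2 * r + m = k)
    (ψ : E [⋀^Fin m]→L[ℝ] ℂ) :
    mixedLefschetz Θ h ψ = ((wedgeFamily r Θ).wedge ψ).domDomCongr (finCongr h) := rfl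

/-- **Junction with the unmixed operator**: for the constant family `(η_ℂ, …, η_ℂ)` the mixed Lefschetz
operator is the tree's iterated Lefschetz operator `Lʳ` (`wedgePow = wedgeFamily` of a constant family).
[cite: Lange2023AbelianVarietiesComplex, §7.3.2] -/
theorem lefschetzPow_eq_mixedLefschetz (η : E [⋀^Fin 2]→L[ℝ] ℝ) (r : ℕ) {m k : ℕ} (h : 2 * r + m = k) :
    lefschetzPow η r h = mixedLefschetz (fun _ : Fin r ↦ ofRealForm η) h := rfl

/-- `L_Θ ψ = 0 ↔ (θ_1 ∧ ⋯ ∧ θ_r) ∧ ψ = 0`. [cite: DinhNguyen2006, §2 Prop. 2.1 (arXiv PDF p. 5)] -/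
theorem mixedLefschetz_eq_zero_iff {r : ℕ} (Θ : Fin r → E [⋀^Fin 2]→L[ℝ] ℂ) {m k : ℕ} (h : 2 * r + m = k)
    (ψ : E [⋀^Fin m]→L[ℝ] ℂ) : mixedLefschetz Θ h ψ = 0 ↔ (wedgeFamily r Θ).wedge ψ = 0 := by
  rw [mixedLefschetz_apply, domDomCongr_finCongr_eq_zero_iff]

/-- The mixed Lefschetz operator in the ring of graded forms: `of k (L_Θ ψ) = of (2r) Ω_Θ * of m ψ`.
[cite: WarnerGTM94, 2.6] -/
theorem gof_mixedLefschetz {r : ℕ} (Θ : Fin r → E [⋀^Fin 2]→L[ℝ] ℂ) {m k : ℕ} (h : 2 * r + m = k)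
    (ψ : E [⋀^Fin m]→L[ℝ] ℂ) :
    GForm.of k (mixedLefschetz Θ h ψ) = GForm.of (2 * r) (wedgeFamily r Θ) * GForm.of m ψ := by
  rw [mixedLefschetz_apply, GForm.of_domDomCongr_finCongr, GForm.of_mul_of]

/-- **The mixed primitive forms `P_Θ^m := ker (L_Θ : ⋀ᵐ V → ⋀^{2r+m} V)`** of a family `Θ = (θ_1, …, θ_r)` —
Dinh–Nguyên's `P^{p,q} := {α ∈ Λ^{p,q} : α ∧ ω_1 ∧ ⋯ ∧ ω_{n-p-q} ∧ ω_{n-p-q+1} = 0}` is its intersection with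
`Λ^{p,q}` for the family `(ω_1, …, ω_{n-p-q+1})` of length `r = n - p - q + 1`; Cattani's
`ker (L_{ω_1} ⋯ L_{ω_m} L_{ω_{m+1}})`. For the constant family of length `g - m + 1` it is the tree's
`primitiveForms` (`primitiveForms_eq_mixedPrimitiveForms`). [cite: DinhNguyen2006, §2 before Prop. 2.1 (arXiv PDF p. 5)]
[cite: Cattani2008MixedLefschetz, Thm. 1.4] -/
def mixedPrimitiveForms {r : ℕ} (Θ : Fin r → E [⋀^Fin 2]→L[ℝ] ℂ) (m : ℕ) : Submodule ℂ (E [⋀^Fin m]→L[ℝ] ℂ) :=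
  LinearMap.ker (mixedLefschetz Θ (m := m) rfl)

/-- Membership in `P_Θ^m`: `(θ_1 ∧ ⋯ ∧ θ_r) ∧ ψ = 0`. [cite: DinhNguyen2006, §2 before Prop. 2.1 (arXiv PDF p. 5)] -/
theorem mem_mixedPrimitiveForms_iff {r : ℕ} (Θ : Fin r → E [⋀^Fin 2]→L[ℝ] ℂ) {m : ℕ} (ψ : E [⋀^Fin m]→L[ℝ] ℂ) :
    ψ ∈ mixedPrimitiveForms Θ m ↔ (wedgeFamily r Θ).wedge ψ = 0 := by
  rw [mixedPrimitiveForms, LinearMap.mem_ker, mixedLefschetz_eq_zero_iff]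

/-- **Junction with the unmixed primitive forms**: for `(g - m + 1) = r` and the constant family `(η_ℂ, …, η_ℂ)`
of that length, `P_Θ^m` is Lange's `P^m = ker L^{g-m+1}` (`primitiveForms η m`).
[cite: Lange2023AbelianVarietiesComplex, §7.3.2] -/
theorem primitiveForms_eq_mixedPrimitiveForms (η : E [⋀^Fin 2]→L[ℝ] ℝ) {m r : ℕ} (hr : finrank ℂ E - m + 1 = r) :
    primitiveForms η m = mixedPrimitiveForms (fun _ : Fin r ↦ ofRealForm η) m := by
  subst hr
  ext ψ
  rw [mem_primitiveForms_iff, mem_mixedPrimitiveForms_iff]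
  rfl

/-- `wedgeFamily (r+1) Θ = (wedgeFamily r (init Θ)) ∧ θ_last` in the ring of graded forms.
[cite: Lange2023AbelianVarietiesComplex, §7.3.1] -/
theorem gof_wedgeFamily_succ {r : ℕ} (Θ : Fin (r + 1) → E [⋀^Fin 2]→L[ℝ] ℂ) :
    GForm.of (2 * (r + 1)) (wedgeFamily (r + 1) Θ) =
      GForm.of (2 * r) (wedgeFamily r (Fin.init Θ)) * GForm.of 2 (Θ (Fin.last r)) := by
  rw [wedgeFamily_succ, GForm.of_mul_of]
  rfl

/-- `wedgeFamily (r+2) (Θ, ω') = (wedgeFamily r (init Θ)) ∧ θ_last ∧ ω'` in the ring of graded forms.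
[cite: Lange2023AbelianVarietiesComplex, §7.3.1] -/
theorem gof_wedgeFamily_snoc {r : ℕ} (Θ : Fin (r + 1) → E [⋀^Fin 2]→L[ℝ] ℂ) (ω' : E [⋀^Fin 2]→L[ℝ] ℂ) :
    GForm.of (2 * (r + 2)) (wedgeFamily (r + 2) (Fin.snoc Θ ω')) =
      GForm.of (2 * r) (wedgeFamily r (Fin.init Θ)) * GForm.of 2 (Θ (Fin.last r)) * GForm.of 2 ω' := by
  rw [show wedgeFamily (r + 2) (Fin.snoc Θ ω') = (wedgeFamily (r + 1) Θ).wedge ω' from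
      (wedgeFamily_wedge_eq_wedgeFamily_snoc Θ ω').symm]
  show GForm.of (2 * (r + 1) + 2) ((wedgeFamily (r + 1) Θ).wedge ω') = _
  rw [← GForm.of_mul_of, gof_wedgeFamily_succ]

/-- **`L_Θ (C ∧ θ_last) = L_{(Θ, θ_last)} C`**: wedging the last background form once more on the argument is the
mixed Lefschetz operator of the family with that form repeated (`2`-forms are central).
[cite: WarnerGTM94, 2.6] [cite: DinhNguyen2006, §2 Prop. 2.1 (c) (arXiv PDF p. 5)] -/
theorem mixedLefschetz_wedge_last {r : ℕ} (Θ : Fin (r + 1) → E [⋀^Fin 2]→L[ℝ] ℂ) {m k : ℕ}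
    (h₁ : 2 * (r + 1) + (m + 2) = k) (h₂ : 2 * (r + 2) + m = k) (C : E [⋀^Fin m]→L[ℝ] ℂ) :
    mixedLefschetz Θ h₁ (C.wedge (Θ (Fin.last r))) = mixedLefschetz (Fin.snoc Θ (Θ (Fin.last r))) h₂ C := by
  refine GForm.of_injective k ?_
  rw [gof_mixedLefschetz, gof_mixedLefschetz, gof_wedgeFamily_succ, gof_wedgeFamily_snoc, ← GForm.of_mul_of,
    ← GForm.of_mul_comm_of_even even_two (Θ (Fin.last r)) (GForm.of m C)]
  simp only [mul_assoc]

/-- `(θ_1 ∧ ⋯ ∧ θ_{r+1}) ∧ (C ∧ θ_{r+1}) = 0 ↔ (θ_1 ∧ ⋯ ∧ θ_{r+1} ∧ θ_{r+1}) ∧ C = 0`.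
[cite: DinhNguyen2006, §2 Prop. 2.1 (c) (arXiv PDF p. 5)] -/
theorem wedgeFamily_wedge_wedge_last_eq_zero_iff {r m : ℕ} (Θ : Fin (r + 1) → E [⋀^Fin 2]→L[ℝ] ℂ)
    (C : E [⋀^Fin m]→L[ℝ] ℂ) :
    (wedgeFamily (r + 1) Θ).wedge (C.wedge (Θ (Fin.last r))) = 0 ↔
      (wedgeFamily (r + 2) (Fin.snoc Θ (Θ (Fin.last r)))).wedge C = 0 := by
  rw [← mixedLefschetz_eq_zero_iff Θ (k := 2 * (r + 2) + m) (by ring), mixedLefschetz_wedge_last Θ _ rfl,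
    mixedLefschetz_eq_zero_iff]

end Defs

/-! ## §2 Types: `L_Θ Λ^{p,q} ⊆ Λ^{r+p, r+q}`; conjugation -/

section Types

variable {E : Type*} [NormedAddCommGroup E] [NormedSpace ℂ E]

/-- Reindexing preserves the pointwise type. [folklore] -/
private theorem isOfTypeAt_domDomCongr_finCongr_iff {n n' p q : ℕ} (h : n = n') (η : E [⋀^Fin n]→L[ℝ] ℂ) :
    IsOfTypeAt p q (η.domDomCongr (finCongr h)) ↔ IsOfTypeAt p q η := by
  subst h; exact Iff.rfl

/-- Transport of a pointwise type along equal bidegrees. [folklore] -/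
private theorem isOfTypeAt_congr {k p q p' q' : ℕ} {η : E [⋀^Fin k]→L[ℝ] ℂ} (h : IsOfTypeAt p q η)
    (hp : p = p') (hq : q = q') : IsOfTypeAt p' q' η := by
  subst hp; subst hq; exact h

/-- A form of type `(p,q)` with `q > dim_ℂ E` vanishes (conjugate of Voisin's `Λ^{p,q} = 0` for `p > n`).
[cite: VoisinHodgeI2002, §2.3.1] -/
private theorem eq_zero_of_finrank_lt_snd' [FiniteDimensional ℂ E] {k p q : ℕ} {ψ : E [⋀^Fin k]→L[ℝ] ℂ}
    (hψ : IsOfTypeAt p q ψ) (hq : finrank ℂ E < q) : ψ = 0 := by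
  have h := (isOfTypeAt_conjForm hψ).eq_zero_of_finrank_lt_fst hq
  rwa [conj_eq_zero_iff] at h

/-- **Types add under the mixed Lefschetz operator: `L_Θ Λ^{p,q} ⊆ Λ^{r+p, r+q}`** for a `(1,1)` family `Θ` of
length `r` (Prop. 2.1 (a): `Ω ∧ ·` maps `Λ^{p,q}` to `Λ^{n-q, n-p}`). [cite: VoisinHodgeI2002, §2.3.1]
[cite: DinhNguyen2006, §2 Prop. 2.1 (a) (arXiv PDF p. 5)] -/
theorem isOfTypeAt_mixedLefschetz {r : ℕ} {Θ : Fin r → E [⋀^Fin 2]→L[ℝ] ℂ} (hΘ : ∀ j, IsOfTypeAt 1 1 (Θ j))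
    {m k p q : ℕ} (h : 2 * r + m = k) {ψ : E [⋀^Fin m]→L[ℝ] ℂ} (hψ : IsOfTypeAt p q ψ) :
    IsOfTypeAt (r + p) (r + q) (mixedLefschetz Θ h ψ) := by
  rw [mixedLefschetz_apply, isOfTypeAt_domDomCongr_finCongr_iff]
  exact (isOfTypeAt_wedgeFamily hΘ).wedge hψ

/-- `L_Θ Λ^{p,q} ⊆ Λ^{r+p, r+q}`, submodule form. [cite: DinhNguyen2006, §2 Prop. 2.1 (a) (arXiv PDF p. 5)] -/
theorem mixedLefschetz_mem_typeSubmodule {r : ℕ} {Θ : Fin r → E [⋀^Fin 2]→L[ℝ] ℂ} (hΘ : ∀ j, IsOfTypeAt 1 1 (Θ j))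
    {m k p q : ℕ} (h : 2 * r + m = k) (hpq : p + q = m) {ψ : E [⋀^Fin m]→L[ℝ] ℂ} (hψ : ψ ∈ typeSubmodule E m p q) :
    mixedLefschetz Θ h ψ ∈ typeSubmodule E k (r + p) (r + q) :=
  (isOfTypeAt_mixedLefschetz hΘ h (isOfTypeAt_of_mem_typeSubmodule hpq hψ)).mem_typeSubmodule

/-- `C ∧ ω ∈ Λ^{p+1, q+1}` for `C ∈ Λ^{p,q}` and `ω` of type `(1,1)`. [cite: VoisinHodgeI2002, §2.3.1] -/
theorem wedge_mem_typeSubmodule_succ {m p q : ℕ} (hpq : p + q = m) {C : E [⋀^Fin m]→L[ℝ] ℂ}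
    (hC : C ∈ typeSubmodule E m p q) {ω : E [⋀^Fin 2]→L[ℝ] ℂ} (hω : IsOfTypeAt 1 1 ω) :
    C.wedge ω ∈ typeSubmodule E (m + 2) (p + 1) (q + 1) :=
  ((isOfTypeAt_of_mem_typeSubmodule hpq hC).wedge hω).mem_typeSubmodule

/-- A family of REAL complex `2`-forms (`θ̄_j = θ_j`) has a real monomial: `conj (θ_1 ∧ ⋯ ∧ θ_r) = θ_1 ∧ ⋯ ∧ θ_r`.
[cite: Lange2023AbelianVarietiesComplex, §1.1.5 Thm. 1.1.21] -/
theorem conjForm_wedgeFamily_of_real {r : ℕ} {Θ : Fin r → E [⋀^Fin 2]→L[ℝ] ℂ} (hΘ : ∀ j, conjForm (Θ j) = Θ j) :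
    conjForm (wedgeFamily r Θ) = wedgeFamily r Θ := by
  rw [conjForm_wedgeFamily]
  exact congrArg (wedgeFamily r) (funext hΘ)

/-- **`P_Θ` is stable under conjugation** for a real family `Θ`: `conj ((θ_1 ∧ ⋯ ∧ θ_r) ∧ ψ) = (θ_1 ∧ ⋯ ∧ θ_r) ∧ ψ̄`.
[cite: DinhNguyen2006, §2 (arXiv PDF p. 5)] [cite: VoisinHodgeI2002, §2.3.1] -/
theorem conjForm_mem_mixedPrimitiveForms {r : ℕ} {Θ : Fin r → E [⋀^Fin 2]→L[ℝ] ℂ} (hΘ : ∀ j, conjForm (Θ j) = Θ j)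
    {m : ℕ} {ψ : E [⋀^Fin m]→L[ℝ] ℂ} (hψ : ψ ∈ mixedPrimitiveForms Θ m) : conjForm ψ ∈ mixedPrimitiveForms Θ m := by
  rw [mem_mixedPrimitiveForms_iff] at hψ ⊢
  rw [← conjForm_wedgeFamily_of_real hΘ, ← conj_wedge, hψ, conj_zero]

end Types

/-! ## §3 The mixed Lefschetz decomposition `Λ^{p+1,q+1} = P^{p+1,q+1} ⊕ ω ∧ Λ^{p,q}` from mixed hard Lefschetz in
degree `p + q` (Dinh–Nguyên Prop. 2.1 (c); Cattani Thm. 2.2 in the mixed setting) -/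

section Decomposition

variable {E : Type*} [NormedAddCommGroup E] [NormedSpace ℂ E]

/-- **Uniqueness in the mixed Lefschetz decomposition**: for a family `Θ = (θ_1, …, θ_r, ω)` and the mixed hard
Lefschetz hypothesis "`(θ_1 ∧ ⋯ ∧ θ_r ∧ ω ∧ ω) ∧ C = 0 ⇒ C = 0` on `Λ^{p,q}`", a primitive form `B`
(`(θ_1 ∧ ⋯ ∧ θ_r ∧ ω) ∧ B = 0`) and `C ∈ Λ^{p,q}` with `B + C ∧ ω = 0` are both zero (wedge the relation with
`θ_1 ∧ ⋯ ∧ θ_r ∧ ω`). [cite: DinhNguyen2006, §2 Prop. 2.1 (c) (arXiv PDF p. 5)] [cite: Cattani2008MixedLefschetz, Thm. 2.2]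
[cite: Huybrechts2005, Prop. 1.2.30 (ii) (proof)] -/
theorem eq_zero_of_mem_mixedPrimitiveForms_of_add_wedge_eq_zero {r m p q : ℕ} (Θ : Fin (r + 1) → E [⋀^Fin 2]→L[ℝ] ℂ)
    (hHL : ∀ C ∈ typeSubmodule E m p q, (wedgeFamily (r + 2) (Fin.snoc Θ (Θ (Fin.last r)))).wedge C = 0 → C = 0)
    {B : E [⋀^Fin (m + 2)]→L[ℝ] ℂ} (hB : B ∈ mixedPrimitiveForms Θ (m + 2)) {C : E [⋀^Fin m]→L[ℝ] ℂ}
    (hC : C ∈ typeSubmodule E m p q) (hBC : B + C.wedge (Θ (Fin.last r)) = 0) : C = 0 ∧ B = 0 := by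
  rw [mem_mixedPrimitiveForms_iff] at hB
  have h1 : (wedgeFamily (r + 1) Θ).wedge (C.wedge (Θ (Fin.last r))) = 0 := by
    have h := congrArg (fun x ↦ (wedgeFamily (r + 1) Θ).wedge x) hBC
    simpa only [ContinuousAlternatingMap.wedge_add_right, hB, zero_add, ContinuousAlternatingMap.wedge_zero] using h
  have hC0 : C = 0 := hHL C hC ((wedgeFamily_wedge_wedge_last_eq_zero_iff Θ C).1 h1)
  refine ⟨hC0, ?_⟩
  rwa [hC0, ContinuousAlternatingMap.zero_wedge, add_zero] at hBC

variable [FiniteDimensional ℂ E]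

/-- **`dim Λ^{r+2+p, r+2+q} = dim Λ^{p,q} = C(g,p) C(g,q)`** on a space of dimension `g = r + p + q + 2`
(`Λ^{r+2+p, r+2+q} = Λ^{g-q, g-p}`). [cite: Lange2023AbelianVarietiesComplex, §1.1.5 Prop. 1.1.23]
[cite: DinhNguyen2006, §2 Prop. 2.1 (a) (arXiv PDF p. 5)] -/
theorem finrank_typeSubmodule_shift_two_eq {g r m p q k : ℕ} (hg : finrank ℂ E = g) (hpq : p + q = m)
    (hrk : r + (m + 2) = g) (hk : (r + 2 + p) + (r + 2 + q) = k) :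
    finrank ℂ (typeSubmodule E k (r + 2 + p) (r + 2 + q)) = finrank ℂ (typeSubmodule E m p q) := by
  rw [finrank_typeSubmodule (k := k) (p := r + 2 + p) (q := r + 2 + q) hk, finrank_typeSubmodule hpq, hg,
    Nat.choose_symm_of_eq_add (show g = (r + 2 + p) + q by omega),
    Nat.choose_symm_of_eq_add (show g = (r + 2 + q) + p by omega), mul_comm]

/-- **Existence in the mixed Lefschetz decomposition** (Prop. 2.1 (c): "`Q`-orthogonal splitting
`Λ^{p,q} = P^{p,q} ⊕ ω_{n-p-q+1} ∧ Λ^{p-1,q-1}`", here written for `Λ^{p+1,q+1}`): under the mixed hard Lefschetz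
hypothesis for `Λ^{p,q}` and the family `(θ_1, …, θ_r, ω, ω)` on a torus of dimension `g = r + p + q + 2`, every
`A ∈ Λ^{p+1,q+1}` is `B + C ∧ ω` with `B ∈ P^{p+1,q+1}` primitive for `(θ_1, …, θ_r, ω)` and `C ∈ Λ^{p,q}`: the
operator `C ↦ (θ_1 ∧ ⋯ ∧ θ_r ∧ ω) ∧ (C ∧ ω) = (θ_1 ∧ ⋯ ∧ θ_r ∧ ω ∧ ω) ∧ C` is injective on `Λ^{p,q}`, hence onto
`Λ^{r+2+p, r+2+q}` (equal dimensions), which contains `(θ_1 ∧ ⋯ ∧ θ_r ∧ ω) ∧ A`.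
[cite: DinhNguyen2006, §2 Prop. 2.1 (c) (arXiv PDF p. 5)] [cite: Cattani2008MixedLefschetz, Thm. 2.2]
[cite: Huybrechts2005, Prop. 1.2.30 (ii)] -/
theorem exists_mem_mixedPrimitiveForms_add_wedge_eq {g r m p q : ℕ} (hg : finrank ℂ E = g) (hpq : p + q = m)
    (hrk : r + (m + 2) = g) {Θ : Fin (r + 1) → E [⋀^Fin 2]→L[ℝ] ℂ} (hΘ : ∀ j, IsOfTypeAt 1 1 (Θ j))
    (hHL : ∀ C ∈ typeSubmodule E m p q, (wedgeFamily (r + 2) (Fin.snoc Θ (Θ (Fin.last r)))).wedge C = 0 → C = 0)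
    {A : E [⋀^Fin (m + 2)]→L[ℝ] ℂ} (hA : A ∈ typeSubmodule E (m + 2) (p + 1) (q + 1)) :
    ∃ B ∈ mixedPrimitiveForms Θ (m + 2) ⊓ typeSubmodule E (m + 2) (p + 1) (q + 1),
      ∃ C ∈ typeSubmodule E m p q, A = B + C.wedge (Θ (Fin.last r)) := by
  set ω := Θ (Fin.last r) with hω
  set k := 2 * (r + 1) + (m + 2) with hk
  set M : (E [⋀^Fin (m + 2)]→L[ℝ] ℂ) →ₗ[ℂ] (E [⋀^Fin k]→L[ℝ] ℂ) := mixedLefschetz Θ (m := m + 2) (k := k) rfl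
    with hM
  -- the target type `T = Λ^{r+2+p, r+2+q}` and the operator `N : C ↦ M (C ∧ ω)` on `Λ^{p,q}`
  set T := typeSubmodule E k (r + 2 + p) (r + 2 + q) with hT
  have hMT : ∀ {A}, A ∈ typeSubmodule E (m + 2) (p + 1) (q + 1) → M A ∈ T := fun {A} hA ↦ by
    have h := isOfTypeAt_mixedLefschetz hΘ (rfl : 2 * (r + 1) + (m + 2) = k)
      (isOfTypeAt_of_mem_typeSubmodule (by omega) hA)
    exact (isOfTypeAt_congr h (by ring) (by ring)).mem_typeSubmodule
  have hwedge : ∀ {C}, C ∈ typeSubmodule E m p q → C.wedge ω ∈ typeSubmodule E (m + 2) (p + 1) (q + 1) :=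
    fun {C} hC ↦ wedge_mem_typeSubmodule_succ hpq hC (hΘ _)
  set N : typeSubmodule E m p q →ₗ[ℂ] T :=
    { toFun := fun C ↦ ⟨M ((C : E [⋀^Fin m]→L[ℝ] ℂ).wedge ω), hMT (hwedge C.2)⟩
      map_add' := fun C C' ↦ by
        apply Subtype.ext
        simp only [Submodule.coe_add, ContinuousAlternatingMap.wedge_add_left, map_add]
      map_smul' := fun c C ↦ by
        apply Subtype.ext
        simp only [Submodule.coe_smul, wedge_smul_left_complex, map_smul, RingHom.id_apply] } with hN
  have hNinj : Function.Injective N := by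
    rw [injective_iff_map_eq_zero]
    intro C hC
    have h0 : M ((C : E [⋀^Fin m]→L[ℝ] ℂ).wedge ω) = 0 := congrArg Subtype.val hC
    rw [hM, mixedLefschetz_eq_zero_iff, hω, wedgeFamily_wedge_wedge_last_eq_zero_iff] at h0
    exact Subtype.ext (hHL C C.2 h0)
  have hdim : finrank ℂ (typeSubmodule E m p q) = finrank ℂ T :=
    (finrank_typeSubmodule_shift_two_eq hg hpq hrk (by omega)).symm
  have hNsurj : Function.Surjective N :=
    (LinearMap.injective_iff_surjective_of_finrank_eq_finrank hdim).1 hNinj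
  obtain ⟨C, hC⟩ := hNsurj ⟨M A, hMT hA⟩
  have hC' : M ((C : E [⋀^Fin m]→L[ℝ] ℂ).wedge ω) = M A := congrArg Subtype.val hC
  refine ⟨A - (C : E [⋀^Fin m]→L[ℝ] ℂ).wedge ω, ⟨?_, ?_⟩, C, C.2, (sub_add_cancel _ _).symm⟩
  · show A - (C : E [⋀^Fin m]→L[ℝ] ℂ).wedge ω ∈ LinearMap.ker M
    rw [LinearMap.mem_ker, map_sub, hC', sub_self]
  · exact Submodule.sub_mem _ hA (hwedge C.2)

/-- **The dimension of the mixed primitive space: `dim P^{p+1,q+1} = C(g,p+1) C(g,q+1) - C(g,p) C(g,q)`**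
(`= dim Λ^{p+1,q+1} - dim Λ^{p,q}`), under the mixed hard Lefschetz hypothesis for `Λ^{p,q}` — the operator
`(θ_1 ∧ ⋯ ∧ θ_r ∧ ω) ∧ ·` maps `Λ^{p+1,q+1}` ONTO `Λ^{r+2+p, r+2+q} ≅ Λ^{p,q}` (rank–nullity).
[cite: DinhNguyen2006, §2 Prop. 2.1 (c) (arXiv PDF p. 5)] [cite: Cattani2008MixedLefschetz, Thm. 2.2]
[cite: Lange2023AbelianVarietiesComplex, §1.1.5 Prop. 1.1.23] -/
theorem finrank_mixedPrimitiveForms_inf_typeSubmodule_add {g r m p q : ℕ} (hg : finrank ℂ E = g) (hpq : p + q = m)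
    (hrk : r + (m + 2) = g) {Θ : Fin (r + 1) → E [⋀^Fin 2]→L[ℝ] ℂ} (hΘ : ∀ j, IsOfTypeAt 1 1 (Θ j))
    (hHL : ∀ C ∈ typeSubmodule E m p q, (wedgeFamily (r + 2) (Fin.snoc Θ (Θ (Fin.last r)))).wedge C = 0 → C = 0) :
    finrank ℂ ↥(mixedPrimitiveForms Θ (m + 2) ⊓ typeSubmodule E (m + 2) (p + 1) (q + 1)) +
        finrank ℂ (typeSubmodule E m p q) =
      finrank ℂ (typeSubmodule E (m + 2) (p + 1) (q + 1)) := by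
  set ω := Θ (Fin.last r) with hω
  set k := 2 * (r + 1) + (m + 2) with hk
  set V := typeSubmodule E (m + 2) (p + 1) (q + 1) with hV
  set M : (E [⋀^Fin (m + 2)]→L[ℝ] ℂ) →ₗ[ℂ] (E [⋀^Fin k]→L[ℝ] ℂ) := mixedLefschetz Θ (m := m + 2) (k := k) rfl
    with hM
  set T := typeSubmodule E k (r + 2 + p) (r + 2 + q) with hT
  have hMT : ∀ {A}, A ∈ V → M A ∈ T := fun {A} hA ↦ by
    have h := isOfTypeAt_mixedLefschetz hΘ (rfl : 2 * (r + 1) + (m + 2) = k)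
      (isOfTypeAt_of_mem_typeSubmodule (by omega) hA)
    exact (isOfTypeAt_congr h (by ring) (by ring)).mem_typeSubmodule
  have hwedge : ∀ {C}, C ∈ typeSubmodule E m p q → C.wedge ω ∈ V :=
    fun {C} hC ↦ wedge_mem_typeSubmodule_succ hpq hC (hΘ _)
  -- `M|_V : V → T` is onto: already `C ↦ M (C ∧ ω)`, `C ∈ Λ^{p,q}`, is onto `T`
  set MV : V →ₗ[ℂ] T := (M.domRestrict V).codRestrict T (fun A ↦ hMT A.2) with hMV
  have hsurj : Function.Surjective MV := by
    intro t
    set N : typeSubmodule E m p q →ₗ[ℂ] T :=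
      { toFun := fun C ↦ ⟨M ((C : E [⋀^Fin m]→L[ℝ] ℂ).wedge ω), hMT (hwedge C.2)⟩
        map_add' := fun C C' ↦ by
          apply Subtype.ext
          simp only [Submodule.coe_add, ContinuousAlternatingMap.wedge_add_left, map_add]
        map_smul' := fun c C ↦ by
          apply Subtype.ext
          simp only [Submodule.coe_smul, wedge_smul_left_complex, map_smul, RingHom.id_apply] } with hN
    have hNinj : Function.Injective N := by
      rw [injective_iff_map_eq_zero]
      intro C hC
      have h0 : M ((C : E [⋀^Fin m]→L[ℝ] ℂ).wedge ω) = 0 := congrArg Subtype.val hC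
      rw [hM, mixedLefschetz_eq_zero_iff, hω, wedgeFamily_wedge_wedge_last_eq_zero_iff] at h0
      exact Subtype.ext (hHL C C.2 h0)
    have hdim : finrank ℂ (typeSubmodule E m p q) = finrank ℂ T :=
      (finrank_typeSubmodule_shift_two_eq hg hpq hrk (by omega)).symm
    obtain ⟨C, hC⟩ := (LinearMap.injective_iff_surjective_of_finrank_eq_finrank hdim).1 hNinj t
    refine ⟨⟨(C : E [⋀^Fin m]→L[ℝ] ℂ).wedge ω, hwedge C.2⟩, ?_⟩
    apply Subtype.ext
    rw [hMV, LinearMap.codRestrict_apply, LinearMap.domRestrict_apply]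
    exact congrArg Subtype.val hC
  -- rank–nullity for `MV`
  have hrn := LinearMap.finrank_range_add_finrank_ker MV
  rw [LinearMap.range_eq_top.2 hsurj, finrank_top] at hrn
  have hker : finrank ℂ (LinearMap.ker MV) = finrank ℂ ↥(mixedPrimitiveForms Θ (m + 2) ⊓ V) := by
    have hle : mixedPrimitiveForms Θ (m + 2) ⊓ V ≤ V := inf_le_right
    have heq : LinearMap.ker MV = (mixedPrimitiveForms Θ (m + 2) ⊓ V).comap V.subtype := by
      ext A
      simp only [hMV, LinearMap.mem_ker, Submodule.mem_comap, Submodule.coe_subtype, Submodule.mem_inf,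
        mixedPrimitiveForms, hM]
      constructor
      · intro h
        exact ⟨by simpa using congrArg Subtype.val h, A.2⟩
      · rintro ⟨h, -⟩
        exact Subtype.ext (by simpa using h)
    rw [heq]
    exact LinearEquiv.finrank_eq (Submodule.comapSubtypeEquivOfLe hle)
  have hT' : finrank ℂ T = finrank ℂ (typeSubmodule E m p q) :=
    finrank_typeSubmodule_shift_two_eq hg hpq hrk (by omega)
  rw [← hker, ← hT']
  omega

/-- **`dim P^{p+1,q+1} = C(g,p+1) C(g,q+1) - C(g,p) C(g,q)`** (Hodge numbers of a torus of dimension `g`).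
[cite: DinhNguyen2006, §2 Prop. 2.1 (c) (arXiv PDF p. 5)] [cite: Lange2023AbelianVarietiesComplex, §1.1.5 Prop. 1.1.23] -/
theorem finrank_mixedPrimitiveForms_inf_typeSubmodule {g r m p q : ℕ} (hg : finrank ℂ E = g) (hpq : p + q = m)
    (hrk : r + (m + 2) = g) {Θ : Fin (r + 1) → E [⋀^Fin 2]→L[ℝ] ℂ} (hΘ : ∀ j, IsOfTypeAt 1 1 (Θ j))
    (hHL : ∀ C ∈ typeSubmodule E m p q, (wedgeFamily (r + 2) (Fin.snoc Θ (Θ (Fin.last r)))).wedge C = 0 → C = 0) :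
    finrank ℂ ↥(mixedPrimitiveForms Θ (m + 2) ⊓ typeSubmodule E (m + 2) (p + 1) (q + 1)) =
      g.choose (p + 1) * g.choose (q + 1) - g.choose p * g.choose q := by
  have h := finrank_mixedPrimitiveForms_inf_typeSubmodule_add hg hpq hrk hΘ hHL
  have h1 : finrank ℂ (typeSubmodule E m p q) = g.choose p * g.choose q := by
    rw [finrank_typeSubmodule hpq, hg]
  have h2 : finrank ℂ (typeSubmodule E (m + 2) (p + 1) (q + 1)) = g.choose (p + 1) * g.choose (q + 1) := by
    rw [finrank_typeSubmodule (k := m + 2) (p := p + 1) (q := q + 1) (by omega), hg]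
  omega

end Decomposition

/-! ## §4 `Q`-orthogonality of the decomposition and the restriction of `Q` to `ω ∧ Λ^{p,q}` -/

section Orthogonality

variable {E : Type*} [NormedAddCommGroup E] [NormedSpace ℂ E]

/-- `2`-forms are central in the ring of graded forms. [cite: WarnerGTM94, 2.6] -/
private theorem of_two_comm (ω : E [⋀^Fin 2]→L[ℝ] ℂ) (z : GForm E ℂ) : GForm.of 2 ω * z = z * GForm.of 2 ω :=
  GForm.of_mul_comm_of_even even_two ω z

/-- **The mixed Lefschetz decomposition is `Q`-orthogonal** (Prop. 2.1 (c): "`Q`-orthogonal splitting"): for a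
family `(θ_1, …, θ_r, ω)` with `ω` REAL, a primitive form `B` (`(θ_1 ∧ ⋯ ∧ θ_r ∧ ω) ∧ B = 0`) and any `C`,
`(θ_1 ∧ ⋯ ∧ θ_r) ∧ B ∧ conj (C ∧ ω) = 0` — indeed `conj (C ∧ ω) = C̄ ∧ ω` and `ω` commutes past `B`.
[cite: DinhNguyen2006, §2 Prop. 2.1 (c) (arXiv PDF p. 5)] [cite: Cattani2008MixedLefschetz, Thm. 2.2] -/
theorem wedgeFamily_init_wedge_wedge_conjForm_wedge_last_eq_zero {r m : ℕ} {Θ : Fin (r + 1) → E [⋀^Fin 2]→L[ℝ] ℂ}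
    (hω : conjForm (Θ (Fin.last r)) = Θ (Fin.last r)) {B : E [⋀^Fin (m + 2)]→L[ℝ] ℂ}
    (hB : B ∈ mixedPrimitiveForms Θ (m + 2)) (C : E [⋀^Fin m]→L[ℝ] ℂ) :
    (wedgeFamily r (Fin.init Θ)).wedge (B.wedge (conjForm (C.wedge (Θ (Fin.last r))))) = 0 := by
  rw [mem_mixedPrimitiveForms_iff] at hB
  have key : GForm.of (2 * r) (wedgeFamily r (Fin.init Θ)) * GForm.of 2 (Θ (Fin.last r)) * GForm.of (m + 2) B = 0 := by
    rw [← gof_wedgeFamily_succ, GForm.of_mul_of, hB, GForm.of_zero]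
  refine GForm.of_injective (2 * r + ((m + 2) + (m + 2))) ?_
  rw [GForm.of_zero, ← GForm.of_mul_of, ← GForm.of_mul_of, conj_wedge, hω, ← GForm.of_mul_of]
  calc GForm.of (2 * r) (wedgeFamily r (Fin.init Θ)) *
        (GForm.of (m + 2) B * (GForm.of m (conjForm C) * GForm.of 2 (Θ (Fin.last r))))
      = GForm.of (2 * r) (wedgeFamily r (Fin.init Θ)) *
          (GForm.of (m + 2) B * GForm.of 2 (Θ (Fin.last r)) * GForm.of m (conjForm C)) := by
        rw [← of_two_comm (Θ (Fin.last r)) (GForm.of m (conjForm C)), mul_assoc]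
    _ = GForm.of (2 * r) (wedgeFamily r (Fin.init Θ)) * GForm.of 2 (Θ (Fin.last r)) * GForm.of (m + 2) B *
          GForm.of m (conjForm C) := by
        rw [← of_two_comm (Θ (Fin.last r)) (GForm.of (m + 2) B)]
        simp only [mul_assoc]
    _ = 0 := by rw [key, zero_mul]

/-- The conjugate-side statement: `(θ_1 ∧ ⋯ ∧ θ_r) ∧ (C ∧ ω) ∧ B̄ = 0` for `B` primitive, `C` arbitrary, the
family real. [cite: DinhNguyen2006, §2 Prop. 2.1 (c) (arXiv PDF p. 5)] -/
theorem wedgeFamily_init_wedge_wedge_last_wedge_conjForm_eq_zero {r m : ℕ} {Θ : Fin (r + 1) → E [⋀^Fin 2]→L[ℝ] ℂ}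
    (hΘ : ∀ j, conjForm (Θ j) = Θ j) {B : E [⋀^Fin (m + 2)]→L[ℝ] ℂ}
    (hB : B ∈ mixedPrimitiveForms Θ (m + 2)) (C : E [⋀^Fin m]→L[ℝ] ℂ) :
    (wedgeFamily r (Fin.init Θ)).wedge ((C.wedge (Θ (Fin.last r))).wedge (conjForm B)) = 0 := by
  have hB' := conjForm_mem_mixedPrimitiveForms hΘ hB
  rw [mem_mixedPrimitiveForms_iff] at hB'
  refine GForm.of_injective (2 * r + ((m + 2) + (m + 2))) ?_
  rw [GForm.of_zero, ← GForm.of_mul_of, ← GForm.of_mul_of, ← GForm.of_mul_of]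
  calc GForm.of (2 * r) (wedgeFamily r (Fin.init Θ)) *
        (GForm.of m C * GForm.of 2 (Θ (Fin.last r)) * GForm.of (m + 2) (conjForm B))
      = GForm.of (2 * r) (wedgeFamily r (Fin.init Θ)) * GForm.of 2 (Θ (Fin.last r)) *
          (GForm.of m C * GForm.of (m + 2) (conjForm B)) := by
        rw [← of_two_comm (Θ (Fin.last r)) (GForm.of m C)]
        simp only [mul_assoc]
    _ = GForm.of (2 * (r + 1)) (wedgeFamily (r + 1) Θ) * (GForm.of m C * GForm.of (m + 2) (conjForm B)) := by
        rw [← gof_wedgeFamily_succ]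
    _ = GForm.of m C * GForm.of (m + 2) (conjForm B) * GForm.of (2 * (r + 1)) (wedgeFamily (r + 1) Θ) :=
        GForm.of_mul_comm_of_even (even_two_mul (r + 1)) _ _
    _ = GForm.of m C * (GForm.of (2 * (r + 1)) (wedgeFamily (r + 1) Θ) * GForm.of (m + 2) (conjForm B)) := by
        rw [mul_assoc, ← GForm.of_mul_comm_of_even (even_two_mul (r + 1)) (wedgeFamily (r + 1) Θ)
          (GForm.of (m + 2) (conjForm B))]
    _ = 0 := by rw [GForm.of_mul_of, hB', GForm.of_zero, mul_zero]

/-- **`Q` on the summand `ω ∧ Λ^{p,q}` is the degree-`(p+q)` pairing for the background `(θ_1, …, θ_r, ω, ω)`**: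
`(θ_1 ∧ ⋯ ∧ θ_r) ∧ (C ∧ ω) ∧ conj (C' ∧ ω) = (θ_1 ∧ ⋯ ∧ θ_r ∧ ω ∧ ω) ∧ C ∧ C̄'` (the family real) — the
inductive structure of the mixed Hodge–Riemann forms. [cite: DinhNguyen2006, §2 Prop. 2.1 (c) and §3 (arXiv PDF pp. 5–7)]
[cite: Cattani2008MixedLefschetz, Thm. 2.2] -/
theorem wedgeFamily_init_wedge_wedge_last_wedge_conjForm_wedge_last {r m : ℕ} (Θ : Fin (r + 1) → E [⋀^Fin 2]→L[ℝ] ℂ)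
    (hω : conjForm (Θ (Fin.last r)) = Θ (Fin.last r)) (C C' : E [⋀^Fin m]→L[ℝ] ℂ)
    (h : 2 * (r + 2) + (m + m) = 2 * r + ((m + 2) + (m + 2))) :
    (wedgeFamily r (Fin.init Θ)).wedge ((C.wedge (Θ (Fin.last r))).wedge (conjForm (C'.wedge (Θ (Fin.last r))))) =
      ((wedgeFamily (r + 2) (Fin.snoc Θ (Θ (Fin.last r)))).wedge (C.wedge (conjForm C'))).domDomCongr (finCongr h) := by
  refine GForm.of_injective (2 * r + ((m + 2) + (m + 2))) ?_
  have hL : GForm.of (2 * r + ((m + 2) + (m + 2)))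
      ((wedgeFamily r (Fin.init Θ)).wedge ((C.wedge (Θ (Fin.last r))).wedge (conjForm (C'.wedge (Θ (Fin.last r)))))) =
      GForm.of (2 * r) (wedgeFamily r (Fin.init Θ)) *
        (GForm.of m C * GForm.of 2 (Θ (Fin.last r)) * (GForm.of m (conjForm C') * GForm.of 2 (Θ (Fin.last r)))) := by
    rw [← GForm.of_mul_of, ← GForm.of_mul_of, ← GForm.of_mul_of, conj_wedge, hω, ← GForm.of_mul_of]
  have hR : GForm.of (2 * r + ((m + 2) + (m + 2)))
      (((wedgeFamily (r + 2) (Fin.snoc Θ (Θ (Fin.last r)))).wedge (C.wedge (conjForm C'))).domDomCongr (finCongr h)) =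
      GForm.of (2 * r) (wedgeFamily r (Fin.init Θ)) * GForm.of 2 (Θ (Fin.last r)) * GForm.of 2 (Θ (Fin.last r)) *
        (GForm.of m C * GForm.of m (conjForm C')) := by
    rw [GForm.of_domDomCongr_finCongr, ← GForm.of_mul_of, gof_wedgeFamily_snoc, ← GForm.of_mul_of]
  rw [hL, hR]
  calc GForm.of (2 * r) (wedgeFamily r (Fin.init Θ)) *
        (GForm.of m C * GForm.of 2 (Θ (Fin.last r)) * (GForm.of m (conjForm C') * GForm.of 2 (Θ (Fin.last r))))
      = GForm.of (2 * r) (wedgeFamily r (Fin.init Θ)) *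
          (GForm.of 2 (Θ (Fin.last r)) * GForm.of m C * (GForm.of 2 (Θ (Fin.last r)) * GForm.of m (conjForm C'))) := by
        rw [← of_two_comm (Θ (Fin.last r)) (GForm.of m C), ← of_two_comm (Θ (Fin.last r)) (GForm.of m (conjForm C'))]
    _ = GForm.of (2 * r) (wedgeFamily r (Fin.init Θ)) *
          (GForm.of 2 (Θ (Fin.last r)) * (GForm.of m C * GForm.of 2 (Θ (Fin.last r))) * GForm.of m (conjForm C')) := by
        simp only [mul_assoc]
    _ = GForm.of (2 * r) (wedgeFamily r (Fin.init Θ)) *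
          (GForm.of 2 (Θ (Fin.last r)) * (GForm.of 2 (Θ (Fin.last r)) * GForm.of m C) * GForm.of m (conjForm C')) := by
        rw [← of_two_comm (Θ (Fin.last r)) (GForm.of m C)]
    _ = GForm.of (2 * r) (wedgeFamily r (Fin.init Θ)) * GForm.of 2 (Θ (Fin.last r)) * GForm.of 2 (Θ (Fin.last r)) *
          (GForm.of m C * GForm.of m (conjForm C')) := by
        simp only [mul_assoc]

end Orthogonality

/-! ## §5 Non-degeneracy of the mixed Hodge–Riemann pairing `(A, B) ↦ ∫_X Ω ∧ A ∧ B̄` on `Λ^{p,q}` from mixed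
hard Lefschetz (Poincaré duality on invariant forms) -/

section Nondegeneracy

variable {ι : Type*} [Fintype ι] [DecidableEq ι] {E : Type*} [NormedAddCommGroup E] [NormedSpace ℂ E]
  (Φ : (ι → ℝ) ≃L[ℝ] E)

omit [Fintype ι] [DecidableEq ι] in
/-- `γ ∧ (∑ᵢ δᵢ) = ∑ᵢ γ ∧ δᵢ`. [cite: WarnerGTM94, 2.6] -/
private theorem wedge_sum_right {κ : Type*} (s : Finset κ) {a b : ℕ} (γ : E [⋀^Fin a]→L[ℝ] ℂ)
    (δ : κ → E [⋀^Fin b]→L[ℝ] ℂ) : γ.wedge (∑ i ∈ s, δ i) = ∑ i ∈ s, γ.wedge (δ i) := by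
  classical
  induction s using Finset.induction_on with
  | empty => rw [Finset.sum_empty, Finset.sum_empty, ContinuousAlternatingMap.wedge_zero]
  | insert a s ha ih =>
    rw [Finset.sum_insert ha, Finset.sum_insert ha, ContinuousAlternatingMap.wedge_add_right, ih]

include Φ in
/-- **`∫_X Ω ∧ A ∧ B̄ = 0` for all `B ∈ Λ^{p,q}` forces `Ω ∧ A = 0`** (`A ∈ Λ^{p,q}`, `p + q = k`, `Ω = θ_1 ∧ ⋯ ∧ θ_r`
a `(1,1)` monomial on a torus of dimension `g = r + k`): the class `Ω ∧ A ∈ Λ^{r+p, r+q}` pairs to zero with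
`Λ^{q,p} = conj Λ^{p,q}`, and with every other `Λ^{a,b}`, `a + b = k`, for type reasons (`(r+p+a, r+q+b) ≠ (g,g)`),
hence with all of `H^k(X, ℂ)`; Poincaré duality on invariant forms. [cite: VoisinHodgeI2002, §6.3.2 (proof of Thm. 6.33) and §7.1.2]
[cite: DinhNguyen2006, §4 Remarks 4.2 (arXiv PDF p. 9)] [cite: Lange2023AbelianVarietiesComplex, §6.2.4 (p. 310)] -/
theorem wedgeFamily_wedge_eq_zero_of_forall_torusIntegral_eq_zero {g r k p q : ℕ} (e : Fin (2 * g) ≃ ι)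
    {Θ : Fin r → E [⋀^Fin 2]→L[ℝ] ℂ} (hΘ : ∀ j, IsOfTypeAt 1 1 (Θ j)) (hrk : r + k = g) (hpq : p + q = k)
    (h2 : 2 * r + (k + k) = 2 * g) {A : E [⋀^Fin k]→L[ℝ] ℂ} (hA : A ∈ typeSubmodule E k p q)
    (h : ∀ B ∈ typeSubmodule E k p q,
      torusIntegral Φ e (((wedgeFamily r Θ).wedge (A.wedge (conjForm B))).domDomCongr (finCongr h2)) = 0) :
    (wedgeFamily r Θ).wedge A = 0 := by
  haveI := finiteDimensional_complex Φ
  have hg : finrank ℂ E = g := finrank_eq_of_finTwoMulEquiv Φ e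
  set γ := (wedgeFamily r Θ).wedge A with hγ
  have hγt : IsOfTypeAt (r + p) (r + q) γ :=
    (isOfTypeAt_wedgeFamily hΘ).wedge (isOfTypeAt_of_mem_typeSubmodule hpq hA)
  -- `γ ∧ D = 0` for `D ∈ Λ^{q,p}`
  have h1 : ∀ D ∈ typeSubmodule E k q p, γ.wedge D = 0 := by
    intro D hD
    have hB : conjForm D ∈ typeSubmodule E k p q :=
      (isOfTypeAt_conjForm (isOfTypeAt_of_mem_typeSubmodule ((add_comm q p).trans hpq) hD)).mem_typeSubmodule
    have h0 := h (conjForm D) hB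
    rw [Literature.LinearAlgebra.Alternating.conj_conj, torusIntegral_eq_zero_iff,
      domDomCongr_finCongr_eq_zero_iff] at h0
    refine GForm.of_injective (2 * r + k + k) ?_
    rw [hγ, ← GForm.of_mul_of, ← GForm.of_mul_of, GForm.of_zero, mul_assoc, GForm.of_mul_of, GForm.of_mul_of, h0,
      GForm.of_zero]
  -- `γ ∧ δ = 0` for every `δ ∈ H^k(X, ℂ)`: decompose `δ` into types
  have h3 : ∀ δ : E [⋀^Fin k]→L[ℝ] ℂ, γ.wedge δ = 0 := by
    intro δ
    rw [← sum_antidiagonal_typeProjAt δ, wedge_sum_right]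
    refine Finset.sum_eq_zero fun ab hab ↦ ?_
    rw [Finset.HasAntidiagonal.mem_antidiagonal] at hab
    by_cases hq : ab.1 = q
    · have hp : ab.2 = p := by omega
      exact h1 _ (hq ▸ hp ▸ (isOfTypeAt_typeProjAt hab δ).mem_typeSubmodule)
    · have ht := hγt.wedge (isOfTypeAt_typeProjAt hab δ)
      by_cases hlt : g < r + p + ab.1
      · exact ht.eq_zero_of_finrank_lt_fst (by rw [hg]; exact hlt)
      · exact eq_zero_of_finrank_lt_snd' ht (by rw [hg]; omega)
  exact eq_zero_of_forall_right_poincarePairing_eq_zero Φ e (show (2 * r + k) + k = 2 * g by omega) fun δ ↦ by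
    rw [poincarePairing_apply, h3 δ, ContinuousAlternatingMap.coe_zero, Pi.zero_apply]

include Φ in
/-- **Non-degeneracy of the mixed Hodge–Riemann pairing on `Λ^{p,q}` from mixed hard Lefschetz**: if
`Ω ∧ · : Λ^{p,q} → Λ^{r+p, r+q}` is injective (`Ω = θ_1 ∧ ⋯ ∧ θ_r`, torus of dimension `r + p + q`), then
`A ∈ Λ^{p,q}` with `∫_X Ω ∧ A ∧ B̄ = 0` for all `B ∈ Λ^{p,q}` is zero ("the multiplication by `[Ω]` induces an
isomorphism" + Poincaré duality; Cattani: non-degeneracy of `Q(·, N ·)` on `V_ℓ` from the Lefschetz property).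
[cite: DinhNguyen2006, §4 Remarks 4.2 (arXiv PDF p. 9)] [cite: Cattani2008MixedLefschetz, §2 Def. 2.1 and Thm. 2.2]
[cite: VoisinHodgeI2002, §6.3.2 (proof of Thm. 6.33)] -/
theorem eq_zero_of_forall_torusIntegral_wedge_conjForm_eq_zero {g r k p q : ℕ} (e : Fin (2 * g) ≃ ι)
    {Θ : Fin r → E [⋀^Fin 2]→L[ℝ] ℂ} (hΘ : ∀ j, IsOfTypeAt 1 1 (Θ j)) (hrk : r + k = g) (hpq : p + q = k)
    (h2 : 2 * r + (k + k) = 2 * g)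
    (hHL : ∀ A ∈ typeSubmodule E k p q, (wedgeFamily r Θ).wedge A = 0 → A = 0)
    {A : E [⋀^Fin k]→L[ℝ] ℂ} (hA : A ∈ typeSubmodule E k p q)
    (h : ∀ B ∈ typeSubmodule E k p q,
      torusIntegral Φ e (((wedgeFamily r Θ).wedge (A.wedge (conjForm B))).domDomCongr (finCongr h2)) = 0) :
    A = 0 :=
  hHL A hA (wedgeFamily_wedge_eq_zero_of_forall_torusIntegral_eq_zero Φ e hΘ hrk hpq h2 hA h)

end Nondegeneracy

/-! ## §6 Unconditional cases on a complex torus: positive backgrounds in degrees `≤ 4` (mixed hard Lefschetz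
in degrees `0, 1, 2` is in the tree) -/

section Positive

variable {ι : Type*} [Fintype ι] [DecidableEq ι] {E : Type*} [NormedAddCommGroup E] [NormedSpace ℂ E]
  (Φ : (ι → ℝ) ≃L[ℝ] E)

omit [Fintype ι] [DecidableEq ι] in
/-- The complexified negated family is of type `(1,1)`. [cite: VoisinHodgeI2002, §2.3.1] -/
theorem isOfTypeAt_ofRealForm_neg_family {n : ℕ} {θ : Fin n → E [⋀^Fin 2]→L[ℝ] ℝ}
    (h11 : ∀ j (x y : E), θ j ![I • x, I • y] = θ j ![x, y]) (j : Fin n) : IsOfTypeAt 1 1 (ofRealForm (-(θ j))) :=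
  isOfTypeAt_one_one_ofRealForm fun x y ↦ by
    rw [ContinuousAlternatingMap.neg_apply, ContinuousAlternatingMap.neg_apply, h11]

omit [Fintype ι] [DecidableEq ι] in
/-- The complexified negated family is real. [cite: Lange2023AbelianVarietiesComplex, §1.1.5 Thm. 1.1.21] -/
theorem conjForm_ofRealForm_neg_family {n : ℕ} (θ : Fin n → E [⋀^Fin 2]→L[ℝ] ℝ) (j : Fin n) :
    conjForm (ofRealForm (-(θ j))) = ofRealForm (-(θ j)) :=
  conjForm_ofRealForm _

omit [Fintype ι] [DecidableEq ι] in
/-- Repeating the last form of a complexified real family is complexifying the repeated real family.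
[folklore] -/
private theorem snoc_ofRealForm_neg {r : ℕ} (θ : Fin (r + 1) → E [⋀^Fin 2]→L[ℝ] ℝ) :
    Fin.snoc (α := fun _ ↦ E [⋀^Fin 2]→L[ℝ] ℂ) (fun j ↦ ofRealForm (-(θ j))) (ofRealForm (-(θ (Fin.last r)))) =
      fun j ↦ ofRealForm (-(Fin.snoc (α := fun _ ↦ E [⋀^Fin 2]→L[ℝ] ℝ) θ (θ (Fin.last r)) j)) := by
  funext j
  refine Fin.lastCases ?_ (fun i ↦ ?_) j
  · simp only [Fin.snoc_last]
  · simp only [Fin.snoc_castSucc]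

omit [Fintype ι] [DecidableEq ι] in
/-- The repeated real family inherits type `(1,1)`. [folklore] -/
private theorem h11_snoc {r : ℕ} {θ : Fin (r + 1) → E [⋀^Fin 2]→L[ℝ] ℝ}
    (h11 : ∀ j (x y : E), θ j ![I • x, I • y] = θ j ![x, y]) (j : Fin (r + 2)) (x y : E) :
    Fin.snoc (α := fun _ ↦ E [⋀^Fin 2]→L[ℝ] ℝ) θ (θ (Fin.last r)) j ![I • x, I • y] =
      Fin.snoc (α := fun _ ↦ E [⋀^Fin 2]→L[ℝ] ℝ) θ (θ (Fin.last r)) j ![x, y] := by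
  refine Fin.lastCases ?_ (fun i ↦ ?_) j
  · simp only [Fin.snoc_last, h11]
  · simp only [Fin.snoc_castSucc, h11]

omit [Fintype ι] [DecidableEq ι] in
/-- The repeated real family inherits positivity. [folklore] -/
private theorem hpos_snoc {r : ℕ} {θ : Fin (r + 1) → E [⋀^Fin 2]→L[ℝ] ℝ}
    (hpos : ∀ j (v : E), v ≠ 0 → 0 < θ j ![I • v, v]) (j : Fin (r + 2)) (v : E) (hv : v ≠ 0) :
    0 < Fin.snoc (α := fun _ ↦ E [⋀^Fin 2]→L[ℝ] ℝ) θ (θ (Fin.last r)) j ![I • v, v] := by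
  refine Fin.lastCases ?_ (fun i ↦ ?_) j
  · simp only [Fin.snoc_last]; exact hpos _ v hv
  · simp only [Fin.snoc_castSucc]; exact hpos _ v hv

omit [Fintype ι] [DecidableEq ι] in
/-- A `0`-form is the scalar `C()` times the constant form `1`. [folklore] -/
private theorem eq_smul_oneForm₀ (C : E [⋀^Fin 0]→L[ℝ] ℂ) : C = (C fun i ↦ i.elim0) • oneForm₀ E := by
  ext v
  rw [ContinuousAlternatingMap.smul_apply, Literature.Analysis.Complex.oneForm₀_apply, smul_eq_mul, mul_one,
    Subsingleton.elim v fun i ↦ i.elim0]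

include Φ in
/-- **Mixed hard Lefschetz in degree `0` (positive background)**: on a torus of dimension `r + 2`,
`(ω_1 ∧ ⋯ ∧ ω_{r+1} ∧ ω_{r+1}) ∧ C = 0 ⇒ C = 0` for a `0`-form `C` — the top monomial has positive integral
(`torusIntegral_wedgeFamily_pos_of_pos`). [cite: Lange2023AbelianVarietiesComplex, §2.2.1 Lemma 2.2.2 (a)(ii)]
[cite: DinhNguyen2006, §2 Prop. 2.1 (a) (arXiv PDF p. 5)] -/
theorem wedgeFamily_snoc_wedge_eq_zero_imp_of_pos_degZero {r : ℕ} (e : Fin (2 * (r + 2)) ≃ ι)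
    {θ : Fin (r + 1) → E [⋀^Fin 2]→L[ℝ] ℝ} (h11 : ∀ j (x y : E), θ j ![I • x, I • y] = θ j ![x, y])
    (hpos : ∀ j (v : E), v ≠ 0 → 0 < θ j ![I • v, v]) (C : E [⋀^Fin 0]→L[ℝ] ℂ)
    (hC : (wedgeFamily (r + 2) (Fin.snoc (α := fun _ ↦ E [⋀^Fin 2]→L[ℝ] ℂ) (fun j ↦ ofRealForm (-(θ j)))
      (ofRealForm (-(θ (Fin.last r)))))).wedge C = 0) : C = 0 := by
  rw [snoc_ofRealForm_neg] at hC
  have hint := torusIntegral_wedgeFamily_pos_of_pos Φ e _ (h11_snoc h11) (hpos_snoc hpos)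
  have hne : wedgeFamily (r + 2) (fun j ↦ ofRealForm (-(Fin.snoc (α := fun _ ↦ E [⋀^Fin 2]→L[ℝ] ℝ) θ
      (θ (Fin.last r)) j))) ≠ 0 := by
    intro h0
    rw [h0, torusIntegral_zero] at hint
    exact lt_irrefl _ hint
  rw [eq_smul_oneForm₀ C, wedge_smul_right_complex, wedge_oneForm₀, smul_eq_zero] at hC
  rcases hC with hc | h0
  · rw [eq_smul_oneForm₀ C, hc, zero_smul]
  · exact absurd h0 hne

include Φ in
/-- **Mixed hard Lefschetz in degree `1` (positive background)**, in the shape of the decomposition hypothesis: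
on a torus of dimension `r + 3`, `(ω_1 ∧ ⋯ ∧ ω_{r+1} ∧ ω_{r+1}) ∧ C = 0 ⇒ C = 0` for every `1`-form `C` (the tree's
`wedgeFamily_wedge_injective_degreeOne`). [cite: DinhNguyen2006, §1 Theorem B and §2 Prop. 2.1 (a) (arXiv PDF pp. 4–5)] -/
theorem wedgeFamily_snoc_wedge_eq_zero_imp_of_pos_degOne {r : ℕ} (e : Fin (2 * (r + 2 + 1)) ≃ ι)
    {θ : Fin (r + 1) → E [⋀^Fin 2]→L[ℝ] ℝ} (h11 : ∀ j (x y : E), θ j ![I • x, I • y] = θ j ![x, y])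
    (hpos : ∀ j (v : E), v ≠ 0 → 0 < θ j ![I • v, v]) (C : E [⋀^Fin 1]→L[ℝ] ℂ)
    (hC : (wedgeFamily (r + 2) (Fin.snoc (α := fun _ ↦ E [⋀^Fin 2]→L[ℝ] ℂ) (fun j ↦ ofRealForm (-(θ j)))
      (ofRealForm (-(θ (Fin.last r)))))).wedge C = 0) : C = 0 := by
  rw [snoc_ofRealForm_neg] at hC
  have hinj := wedgeFamily_wedge_injective_degreeOne Φ e (h11_snoc h11) (hpos_snoc hpos)
  exact hinj (by simp only [hC, ContinuousAlternatingMap.wedge_zero])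

include Φ in
/-- **Mixed hard Lefschetz in degree `2` (positive background)**, in the shape of the decomposition hypothesis:
on a torus of dimension `r + 4`, `(ω_1 ∧ ⋯ ∧ ω_{r+1} ∧ ω_{r+1}) ∧ C = 0 ⇒ C = 0` for every `2`-form `C` (the tree's
`wedgeFamily_wedge_injective`). [cite: DinhNguyen2006, §4 Remarks 4.2 and §1 Theorem B (arXiv PDF pp. 9, 4)] -/
theorem wedgeFamily_snoc_wedge_eq_zero_imp_of_pos_degTwo {r : ℕ} (e : Fin (2 * (r + 2 + 2)) ≃ ι)
    {θ : Fin (r + 1) → E [⋀^Fin 2]→L[ℝ] ℝ} (h11 : ∀ j (x y : E), θ j ![I • x, I • y] = θ j ![x, y])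
    (hpos : ∀ j (v : E), v ≠ 0 → 0 < θ j ![I • v, v]) (C : E [⋀^Fin 2]→L[ℝ] ℂ)
    (hC : (wedgeFamily (r + 2) (Fin.snoc (α := fun _ ↦ E [⋀^Fin 2]→L[ℝ] ℂ) (fun j ↦ ofRealForm (-(θ j)))
      (ofRealForm (-(θ (Fin.last r)))))).wedge C = 0) : C = 0 := by
  rw [snoc_ofRealForm_neg] at hC
  have hinj := ComplexTorus.wedgeFamily_wedge_injective Φ e (h11_snoc h11) (hpos_snoc hpos)
  exact hinj (by simp only [hC, ContinuousAlternatingMap.wedge_zero])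

include Φ in
/-- **The mixed Lefschetz decomposition in degree `2` on a complex torus (unconditional)**: for Kähler forms
`ω_1, …, ω_{r+1}` on `X` of dimension `r + 2` every `A ∈ Λ^{1,1}` is `B + C ∧ ω_{r+1}` with `B` primitive
(`ω_1 ∧ ⋯ ∧ ω_{r+1} ∧ B = 0`) and `C ∈ Λ^{0,0}`, and `dim P^{1,1} = g² - 1`.
[cite: DinhNguyen2006, §2 Prop. 2.1 (c) (arXiv PDF p. 5)] [cite: Cattani2008MixedLefschetz, Thm. 2.2] -/
theorem mixedLefschetzDecomposition_degTwo_of_pos {r : ℕ} (e : Fin (2 * (r + 2)) ≃ ι)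
    {θ : Fin (r + 1) → E [⋀^Fin 2]→L[ℝ] ℝ} (h11 : ∀ j (x y : E), θ j ![I • x, I • y] = θ j ![x, y])
    (hpos : ∀ j (v : E), v ≠ 0 → 0 < θ j ![I • v, v]) :
    (∀ A ∈ typeSubmodule E (0 + 2) (0 + 1) (0 + 1),
      ∃ B ∈ mixedPrimitiveForms (fun j ↦ ofRealForm (-(θ j))) (0 + 2) ⊓ typeSubmodule E (0 + 2) (0 + 1) (0 + 1),
        ∃ C ∈ typeSubmodule E 0 0 0, A = B + C.wedge (ofRealForm (-(θ (Fin.last r))))) ∧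
    finrank ℂ ↥(mixedPrimitiveForms (fun j ↦ ofRealForm (-(θ j))) (0 + 2) ⊓ typeSubmodule E (0 + 2) (0 + 1) (0 + 1)) =
      (r + 2).choose (0 + 1) * (r + 2).choose (0 + 1) - (r + 2).choose 0 * (r + 2).choose 0 := by
  haveI := finiteDimensional_complex Φ
  have hg : finrank ℂ E = r + 2 := finrank_eq_of_finTwoMulEquiv Φ e
  have hHL : ∀ C ∈ typeSubmodule E 0 0 0, (wedgeFamily (r + 2)
      (Fin.snoc (fun j ↦ ofRealForm (-(θ j))) (ofRealForm (-(θ (Fin.last r)))))).wedge C = 0 → C = 0 :=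
    fun C _ hC ↦ wedgeFamily_snoc_wedge_eq_zero_imp_of_pos_degZero Φ e h11 hpos C hC
  exact ⟨fun A hA ↦ exists_mem_mixedPrimitiveForms_add_wedge_eq (m := 0) (p := 0) (q := 0) hg rfl rfl
      (isOfTypeAt_ofRealForm_neg_family h11) hHL hA,
    finrank_mixedPrimitiveForms_inf_typeSubmodule (m := 0) (p := 0) (q := 0) hg rfl rfl
      (isOfTypeAt_ofRealForm_neg_family h11) hHL⟩

include Φ in
/-- **The mixed Lefschetz decomposition in degree `3` on a complex torus (unconditional)**: for Kähler forms
`ω_1, …, ω_{r+1}` on `X` of dimension `r + 3` and `p + q = 1`, every `A ∈ Λ^{p+1,q+1}` is `B + C ∧ ω_{r+1}` with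
`B ∈ P^{p+1,q+1}` (`ω_1 ∧ ⋯ ∧ ω_{r+1} ∧ B = 0`) and `C ∈ Λ^{p,q}`, and
`dim P^{p+1,q+1} = C(g,p+1) C(g,q+1) - C(g,p) C(g,q)` — from mixed hard Lefschetz in degree one.
[cite: DinhNguyen2006, §2 Prop. 2.1 (c) (arXiv PDF p. 5)] [cite: Cattani2008MixedLefschetz, Thm. 2.2] -/
theorem mixedLefschetzDecomposition_degThree_of_pos {r p q : ℕ} (e : Fin (2 * (r + 2 + 1)) ≃ ι) (hpq : p + q = 1)
    {θ : Fin (r + 1) → E [⋀^Fin 2]→L[ℝ] ℝ} (h11 : ∀ j (x y : E), θ j ![I • x, I • y] = θ j ![x, y])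
    (hpos : ∀ j (v : E), v ≠ 0 → 0 < θ j ![I • v, v]) :
    (∀ A ∈ typeSubmodule E (1 + 2) (p + 1) (q + 1),
      ∃ B ∈ mixedPrimitiveForms (fun j ↦ ofRealForm (-(θ j))) (1 + 2) ⊓ typeSubmodule E (1 + 2) (p + 1) (q + 1),
        ∃ C ∈ typeSubmodule E 1 p q, A = B + C.wedge (ofRealForm (-(θ (Fin.last r))))) ∧
    finrank ℂ ↥(mixedPrimitiveForms (fun j ↦ ofRealForm (-(θ j))) (1 + 2) ⊓ typeSubmodule E (1 + 2) (p + 1) (q + 1)) =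
      (r + 2 + 1).choose (p + 1) * (r + 2 + 1).choose (q + 1) - (r + 2 + 1).choose p * (r + 2 + 1).choose q := by
  haveI := finiteDimensional_complex Φ
  have hg : finrank ℂ E = r + 2 + 1 := finrank_eq_of_finTwoMulEquiv Φ e
  have hHL : ∀ C ∈ typeSubmodule E 1 p q, (wedgeFamily (r + 2)
      (Fin.snoc (fun j ↦ ofRealForm (-(θ j))) (ofRealForm (-(θ (Fin.last r)))))).wedge C = 0 → C = 0 :=
    fun C _ hC ↦ wedgeFamily_snoc_wedge_eq_zero_imp_of_pos_degOne Φ e h11 hpos C hC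
  exact ⟨fun A hA ↦ exists_mem_mixedPrimitiveForms_add_wedge_eq (m := 1) hg hpq (by ring)
      (isOfTypeAt_ofRealForm_neg_family h11) hHL hA,
    finrank_mixedPrimitiveForms_inf_typeSubmodule (m := 1) hg hpq (by ring) (isOfTypeAt_ofRealForm_neg_family h11) hHL⟩

include Φ in
/-- **The mixed Lefschetz decomposition in degree `4` on a complex torus (unconditional)**: for Kähler forms
`ω_1, …, ω_{r+1}` on `X` of dimension `r + 4` and `p + q = 2`, every `A ∈ Λ^{p+1,q+1}` is `B + C ∧ ω_{r+1}` with
`B ∈ P^{p+1,q+1}` and `C ∈ Λ^{p,q}`, and `dim P^{p+1,q+1} = C(g,p+1) C(g,q+1) - C(g,p) C(g,q)` (e.g.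
`dim P^{2,2} = C(g,2)² - g²`) — from mixed hard Lefschetz in degree two.
[cite: DinhNguyen2006, §2 Prop. 2.1 (c) (arXiv PDF p. 5)] [cite: Cattani2008MixedLefschetz, Thm. 2.2] -/
theorem mixedLefschetzDecomposition_degFour_of_pos {r p q : ℕ} (e : Fin (2 * (r + 2 + 2)) ≃ ι) (hpq : p + q = 2)
    {θ : Fin (r + 1) → E [⋀^Fin 2]→L[ℝ] ℝ} (h11 : ∀ j (x y : E), θ j ![I • x, I • y] = θ j ![x, y])
    (hpos : ∀ j (v : E), v ≠ 0 → 0 < θ j ![I • v, v]) :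
    (∀ A ∈ typeSubmodule E (2 + 2) (p + 1) (q + 1),
      ∃ B ∈ mixedPrimitiveForms (fun j ↦ ofRealForm (-(θ j))) (2 + 2) ⊓ typeSubmodule E (2 + 2) (p + 1) (q + 1),
        ∃ C ∈ typeSubmodule E 2 p q, A = B + C.wedge (ofRealForm (-(θ (Fin.last r))))) ∧
    finrank ℂ ↥(mixedPrimitiveForms (fun j ↦ ofRealForm (-(θ j))) (2 + 2) ⊓ typeSubmodule E (2 + 2) (p + 1) (q + 1)) =
      (r + 2 + 2).choose (p + 1) * (r + 2 + 2).choose (q + 1) - (r + 2 + 2).choose p * (r + 2 + 2).choose q := by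
  haveI := finiteDimensional_complex Φ
  have hg : finrank ℂ E = r + 2 + 2 := finrank_eq_of_finTwoMulEquiv Φ e
  have hHL : ∀ C ∈ typeSubmodule E 2 p q, (wedgeFamily (r + 2)
      (Fin.snoc (fun j ↦ ofRealForm (-(θ j))) (ofRealForm (-(θ (Fin.last r)))))).wedge C = 0 → C = 0 :=
    fun C _ hC ↦ wedgeFamily_snoc_wedge_eq_zero_imp_of_pos_degTwo Φ e h11 hpos C hC
  exact ⟨fun A hA ↦ exists_mem_mixedPrimitiveForms_add_wedge_eq (m := 2) hg hpq (by ring)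
      (isOfTypeAt_ofRealForm_neg_family h11) hHL hA,
    finrank_mixedPrimitiveForms_inf_typeSubmodule (m := 2) hg hpq (by ring) (isOfTypeAt_ofRealForm_neg_family h11) hHL⟩

end Positive



end ComplexTorus

end Literature.Geometry.Kaehler

end
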